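import Literature.NumberTheory.Automorphic.ArchKirillovRealShapesGL2
import Literature.NumberTheory.Automorphic.ArchKirillovComplexShapesGL2
import Literature.NumberTheory.Automorphic.ArchKirillovBaseVectorNormalFormGL2
import Literature.NumberTheory.Automorphic.ArchTorusCoordinatesGL2
import Literature.NumberTheory.Automorphic.ArchWeightVectorRotation
import Literature.NumberTheory.Automorphic.ArchKirillovBoundGL2
import HarnessLib

/-!
# Shape types of `K_∞`-finite vectors of `GL₂(K_∞)` and their Kirillov functions along the torus
# (Jacquet–Langlands (1970), §5 Thm. 5.13–5.15, §6 Thm. 6.2–6.4)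

Topic `NumberTheory/Automorphic`; namespace `Literature.NumberTheory.Automorphic`. `Prop`-valued
structures (the SHAPE TYPES of a Gårding vector at an archimedean place) and theorems; no named fact,
no instance.

Let `τ` be an irreducible unitary representation of `GL₂(K_∞)` on a Hilbert space, `ℓ` a continuous
`ψ_∞`-Whittaker functional on its Gårding space `𝒢` (`IsArchContWhittakerFunctional`; then
`ℓ(τ(E₀₁ ⊗ r_w) u) = -2πi ℓ(u)` at a real place and `dψ^{hol} = dψ^{anti} = -4πi` at a complex place).
For a vector `v ∈ 𝒢` we single out, at each place `w`, finitely many algebraic SHAPE TYPES (eigen- and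
vanishing conditions for the place-`w` operators `τ(W_w)`, `L_w`, `R_w`, `τ(δ_w)`, `τ(T_w)`, `E_w`, `F_w`, the
Casimir and central scalars being those of `τ`), and prove for each type the shape of the Kirillov function
`t ↦ ℓ(τ(diag(ι_w(t), 1)) v)` on `ℝˣ` (resp. `z ↦ ℓ(τ(diag(ι_w(z),1)) v)` on `ℂˣ`):

* real place (`§2`): `RealDiscPlus` (`L_w v = 0`, weight `k`): `0` on `t > 0`, `c|t|^{(μ+k)/2}e^{-2π|t|}` on
  `t < 0`; `RealDiscMinus` (`R_w v = 0`, weight `-k`): the mirror image; `RealWeightOneSym`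
  (`v = (1 + ητ(δ_w))(v' + (2κ)⁻¹ L_w v')`, `v'` of weight `1`): `c Φ(t)`, `cη Φ(|t|)` with
  `Φ(x) = x^{(μ+1)/2} k_{i(κ-1/2)}(x)`; `RealWeightZero` (`τ(W)v = 0`, `τ(δ)v = εv`): `c Φ(t)`, `cεΦ(|t|)`,
  `Φ = x^{μ/2} k_ν`; `RealWeightZeroX` (`v = τ(X⁺+X⁻)v'`, `v'` of weight `0`, `τ(δ)v' = -εv'`): the same with
  `Φ = x^{μ/2+1} k_ν` — from `ArchKirillovRealShapesGL2`;
* complex place (`§3`): `ComplexHolPow` (`v = τ^h(E₀₁)^b y`, `y` highest of weight `m`), `ComplexAntiPowLowest`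
  (`v = τ^a(E₀₁)^b F^m y`), `ComplexString` (`v = F^j y` plus the minimal-type relation): the radial function
  is `c x^{β} k_ν(x)` and the compact torus `diag(e^{iφ},1)_w` acts through `e^{φ(it+μ₂)/2}`, `t` the
  `T_w`-weight — from `ArchKirillovComplexShapesGL2`;
* every type is TRANSPORTED by the endomorphisms commuting with the place-`w` letters and `τ(δ_w)` (`§4`),
  in particular by `τ(diag(u',1))` for `u'_w = 1` and by operators at the other places.

These are the local ingredients of the archimedean Hecke test vector (`JacquetLanglands1970_twistedHeckeTheoryGL2`).

## References

* H. Jacquet, R. P. Langlands, *Automorphic Forms on GL(2)*, LNM 114 (1970), §5 (Thm. 5.13, 5.15), §6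
  (Thm. 6.2–6.4). [JacquetLanglands1970]
* A. W. Knapp, *Representation Theory of Semisimple Groups* (1986), Ch. VIII §3. [Knapp1986]
-/

noncomputable section

open MeasureTheory Measure NumberField NumberField.InfinitePlace NumberField.mixedEmbedding IsDedekindDomain Set Filter
open scoped MatrixGroups Topology Classical InnerProductSpace

namespace Literature.NumberTheory.Automorphic

variable {K : Type} [Field K] [NumberField K]

-- as in `ArchGardingWhittaker`
set_option backward.isDefEq.respectTransparency false

/-! ### 1. The constants of the Whittaker functional -/

section Constants

variable {hcpt : isCompact_glFiniteIntegralLevel 2 K}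
  {E : Type*} [NormedAddCommGroup E] [InnerProductSpace ℂ E] [CompleteSpace E]
  {τ : ContRepresentation ℂ (AutomorphyDatum.gl 2 K hcpt).arch.carrier E}
  (hτ : τ.IsStronglyContinuous)

/-- The infinitesimal Whittaker covariance in `End(𝒢)`-form: `ℓ(τ(E₀₁ ⊗ x) v) = dψ_∞(E₀₁ ⊗ x) ℓ(v)`.
[cite: Kostant1978Whittaker, §2] -/
theorem apply_gardingEnd_single_zero_one {ℓ : archGardingSpace hcpt τ →ₗ[ℂ] ℂ}
    (hℓW : IsArchContWhittakerFunctional hcpt τ hτ ℓ) (x : mixedSpace K) (v : archGardingSpace hcpt τ) :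
    ℓ (gardingEnd hτ (Matrix.single 0 1 x) v) = archWhittakerDChar K (0 : Fin 2) 1 x * ℓ v :=
  hℓW.apply_archDerivE_single (show (0 : Fin 2) < 1 by decide) x v.2

/-- `dψ_∞(E₀₁ ⊗ r_w) = -2πi` at a real place. [folklore] -/
theorem archWhittakerDChar_realIdem (w : {w : InfinitePlace K // IsReal w}) :
    archWhittakerDChar K (0 : Fin 2) 1 ((Pi.single w 1, 0) : mixedSpace K) = -(2 * Real.pi : ℂ) * Complex.I := by
  have h := (archWhittakerDChar_mul_realIdem (1 : (mixedSpace K)ˣ) w).1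
  rw [Units.val_one, one_mul] at h
  rw [h, Prod.fst_one, Pi.one_apply, mul_one]
  push_cast
  ring

/-- `I · dψ_∞(E₀₁ ⊗ r_w) = 2π`. [folklore] -/
theorem I_mul_archWhittakerDChar_realIdem (w : {w : InfinitePlace K // IsReal w}) :
    Complex.I * archWhittakerDChar K (0 : Fin 2) 1 ((Pi.single w 1, 0) : mixedSpace K) = ((2 * Real.pi : ℝ) : ℂ) := by
  rw [archWhittakerDChar_realIdem]
  push_cast
  ring_nf
  rw [Complex.I_sq]
  ring

/-- `dψ_∞(E₀₁ ⊗ r_w)² = -(2π)²`. [folklore] -/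
theorem archWhittakerDChar_realIdem_sq (w : {w : InfinitePlace K // IsReal w}) :
    archWhittakerDChar K (0 : Fin 2) 1 ((Pi.single w 1, 0) : mixedSpace K) ^ 2 = -(((2 * Real.pi : ℝ) : ℂ) ^ 2) := by
  rw [archWhittakerDChar_realIdem]
  push_cast
  ring_nf
  rw [Complex.I_sq]
  ring

/-- `dψ^{hol} dψ^{anti} = -(4π)²` at a complex place (`z_w = 1`). [folklore] -/
theorem archWhittakerDChar_hol_mul_anti (w : {w : InfinitePlace K // IsComplex w}) :
    (archWhittakerDChar K (0 : Fin 2) 1 ((0, Pi.single w 1) : mixedSpace K) +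
        Complex.I * archWhittakerDChar K (0 : Fin 2) 1 ((0, Pi.single w Complex.I) : mixedSpace K)) *
      (archWhittakerDChar K (0 : Fin 2) 1 ((0, Pi.single w 1) : mixedSpace K) -
        Complex.I * archWhittakerDChar K (0 : Fin 2) 1 ((0, Pi.single w Complex.I) : mixedSpace K)) =
      -(((4 * Real.pi : ℝ) : ℂ) ^ 2) := by
  have h1 := (archWhittakerDChar_hol (1 : (mixedSpace K)ˣ) w).1
  have h2 := (archWhittakerDChar_anti (1 : (mixedSpace K)ˣ) w).1
  rw [Units.val_one, one_mul, one_mul] at h1 h2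
  rw [h1, h2, Prod.snd_one, Pi.one_apply, map_one]
  push_cast
  ring_nf
  rw [Complex.I_sq]
  ring

/-- `dψ^{hol} = dψ(c_w) - i dψ(ic_w) = -4πi` at a complex place. [folklore] -/
theorem archWhittakerDChar_hol_one (w : {w : InfinitePlace K // IsComplex w}) :
    archWhittakerDChar K (0 : Fin 2) 1 ((0, Pi.single w 1) : mixedSpace K) -
        Complex.I * archWhittakerDChar K (0 : Fin 2) 1 ((0, Pi.single w Complex.I) : mixedSpace K) =
      -(4 * Real.pi) * Complex.I := by
  have h1 := (archWhittakerDChar_hol (1 : (mixedSpace K)ˣ) w).1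
  rw [Units.val_one, one_mul, one_mul] at h1
  rw [h1, Prod.snd_one, Pi.one_apply, mul_one]

/-- `dψ^{anti} = -4πi` at a complex place. [folklore] -/
theorem archWhittakerDChar_anti_one (w : {w : InfinitePlace K // IsComplex w}) :
    archWhittakerDChar K (0 : Fin 2) 1 ((0, Pi.single w 1) : mixedSpace K) +
        Complex.I * archWhittakerDChar K (0 : Fin 2) 1 ((0, Pi.single w Complex.I) : mixedSpace K) =
      -(4 * Real.pi) * Complex.I := by
  have h1 := (archWhittakerDChar_anti (1 : (mixedSpace K)ˣ) w).1
  rw [Units.val_one, one_mul, one_mul] at h1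
  rw [h1, Prod.snd_one, Pi.one_apply, map_one, mul_one]

end Constants

/-! ### 2. Real places -/

section RealPlace

variable {hcpt : isCompact_glFiniteIntegralLevel 2 K}
  {E : Type*} [NormedAddCommGroup E] [InnerProductSpace ℂ E] [CompleteSpace E]
  {τ : ContRepresentation ℂ (AutomorphyDatum.gl 2 K hcpt).arch.carrier E}
  (hτ : τ.IsStronglyContinuous) (w : {w : InfinitePlace K // IsReal w})

local notation "H₀" => Matrix.single (0 : Fin 2) (0 : Fin 2) ((Pi.single w 1, 0) : mixedSpace K)
local notation "H₁" => Matrix.single (1 : Fin 2) (1 : Fin 2) ((Pi.single w 1, 0) : mixedSpace K)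
local notation "X⁺" => Matrix.single (0 : Fin 2) (1 : Fin 2) ((Pi.single w 1, 0) : mixedSpace K)
local notation "X⁻" => Matrix.single (1 : Fin 2) (0 : Fin 2) ((Pi.single w 1, 0) : mixedSpace K)
local notation "D" => gardingEnd (hcpt := hcpt) (τ := τ) hτ
local notation "A[" y "]" => gardingAct (hcpt := hcpt) (τ := τ) hτ (expGL ((y : ℝ) • H₀))
local notation "Lo" => (gardingEnd (hcpt := hcpt) (τ := τ) hτ (H₀ - H₁) - Complex.I • gardingEnd (hcpt := hcpt) (τ := τ) hτ (X⁺ + X⁻))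
local notation "Ra" => (gardingEnd (hcpt := hcpt) (τ := τ) hτ (H₀ - H₁) + Complex.I • gardingEnd (hcpt := hcpt) (τ := τ) hτ (X⁺ + X⁻))
local notation "Cas" v:max => (∑ i : Fin 2, ∑ j : Fin 2, gardingEnd (hcpt := hcpt) (τ := τ) hτ (Matrix.single i j ((Pi.single w 1, 0) : mixedSpace K))
  (gardingEnd (hcpt := hcpt) (τ := τ) hτ (Matrix.single j i ((Pi.single w 1, 0) : mixedSpace K)) v))

variable (δ : GL (Fin 2) (mixedSpace K))

/-- **Discrete type, upper half**: weight `k`, central scalar `μ`, killed by the lowering operator.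
[cite: JacquetLanglands1970, §5 Thm. 5.13] -/
structure RealDiscPlus (v : archGardingSpace hcpt τ) (k μ : ℂ) : Prop where
  weyl : D (X⁺ - X⁻) v = (Complex.I * k) • v
  centre : D H₀ v + D H₁ v = μ • v
  lowering : Lo v = 0

/-- **Discrete type, lower half**: weight `-k`, killed by the raising operator. [cite: JacquetLanglands1970, §5 Thm. 5.13] -/
structure RealDiscMinus (v : archGardingSpace hcpt τ) (k μ : ℂ) : Prop where
  weyl : D (X⁺ - X⁻) v = (Complex.I * -k) • v
  centre : D H₀ v + D H₁ v = μ • v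
  raising : Ra v = 0

/-- **Symmetrised weight-one type**: `v = (1 + η τ(δ_w))(v' + (2κ)⁻¹ L_w v')` with `v'` of weight `1`, Casimir
scalar `λ`, `(2κ)² = 2λ - μ² + 1`, `κ ≠ 0`, `η = ±1`. [cite: JacquetLanglands1970, §5 Thm. 5.13] -/
structure RealWeightOneSym (v : archGardingSpace hcpt τ) (η κ μ lam : ℂ) : Prop where
  eta : η = 1 ∨ η = -1
  kappa_sq : (2 * κ) ^ 2 = 2 * lam - μ ^ 2 + 1
  kappa_ne : κ ≠ 0
  exists_inner : ∃ v' : archGardingSpace hcpt τ, D (X⁺ - X⁻) v' = Complex.I • v' ∧ D H₀ v' + D H₁ v' = μ • v' ∧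
    Cas v' = lam • v' ∧ v = (v' + (1 / (2 * κ)) • Lo v') + η • gardingAct hτ δ (v' + (1 / (2 * κ)) • Lo v')

/-- **Weight-zero type with sign `ε`**: `τ(W_w) v = 0`, `τ(δ_w) v = ε v`. [cite: JacquetLanglands1970, §5 Thm. 5.13] -/
structure RealWeightZero (v : archGardingSpace hcpt τ) (ε μ lam : ℂ) : Prop where
  eps : ε = 1 ∨ ε = -1
  weyl : D (X⁺ - X⁻) v = 0
  centre : D H₀ v + D H₁ v = μ • v
  casimir : Cas v = lam • v
  sign : gardingAct hτ δ v = ε • v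

/-- **Modified weight-zero type**: `v = τ(X⁺_w + X⁻_w) v'` with `v'` of weight `0` and `τ(δ_w) v' = -ε v'` (then
`τ(δ_w) v = ε v`). [cite: JacquetLanglands1970, §5 Thm. 5.13] -/
structure RealWeightZeroX (v : archGardingSpace hcpt τ) (ε μ lam : ℂ) : Prop where
  eps : ε = 1 ∨ ε = -1
  exists_inner : ∃ v' : archGardingSpace hcpt τ, D (X⁺ - X⁻) v' = 0 ∧ D H₀ v' + D H₁ v' = μ • v' ∧
    Cas v' = lam • v' ∧ gardingAct hτ δ v' = (-ε) • v' ∧ v = D (X⁺ + X⁻) v'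

variable {δ} {hτ}
  (hδ : (δ : Matrix (Fin 2) (Fin 2) (mixedSpace K)) = 1 - (2 : ℝ) • Matrix.single (0 : Fin 2) (0 : Fin 2) ((Pi.single w 1, 0) : mixedSpace K))

/-! #### Radial Kirillov functions of the real types -/

section Shapes

variable (hτu : τ.IsUnitary) {ℓ : archGardingSpace hcpt τ →ₗ[ℂ] ℂ} (hℓW : IsArchContWhittakerFunctional hcpt τ hτ ℓ)
include hτu hℓW

/-- The standing analytic hypotheses of the series for the actual `τ`, `ℓ`. [folklore] -/
theorem realPlace_hyps :
    (∀ g, ‖(τ g : E →L[ℂ] E)‖ ≤ 1) ∧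
    (∃ (C : ℝ) (𝒮 : Finset (List (Matrix (Fin 2) (Fin 2) (mixedSpace K)))), 0 ≤ C ∧
      ∀ v : archGardingSpace hcpt τ, ‖ℓ v‖ ≤ C * ∑ w ∈ 𝒮, ‖archWordDerivE hcpt τ w v‖) ∧
    (∀ u : archGardingSpace hcpt τ, ℓ (D X⁺ u) = archWhittakerDChar K (0 : Fin 2) 1 ((Pi.single w 1, 0) : mixedSpace K) * ℓ u) ∧
    0 < (Complex.I * archWhittakerDChar K (0 : Fin 2) 1 ((Pi.single w 1, 0) : mixedSpace K)).re ∧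
    Complex.I * archWhittakerDChar K (0 : Fin 2) 1 ((Pi.single w 1, 0) : mixedSpace K) = ((2 * Real.pi : ℝ) : ℂ) ∧
    archWhittakerDChar K (0 : Fin 2) 1 ((Pi.single w 1, 0) : mixedSpace K) ^ 2 = -(((2 * Real.pi : ℝ) : ℂ) ^ 2) ∧
    (0 : ℝ) < 2 * Real.pi := by
  refine ⟨norm_apply_le_one_of_isUnitary hτu, hℓW.norm_le, fun u => apply_gardingEnd_single_zero_one hτ hℓW _ u, ?_,
    I_mul_archWhittakerDChar_realIdem w, archWhittakerDChar_realIdem_sq w, by positivity⟩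
  rw [I_mul_archWhittakerDChar_realIdem, Complex.ofReal_re]
  positivity

include hδ

/-- **Radial function of the upper discrete type**: `0` along `A`, `C e^{(μ+k)y/2} e^{-2πe^y}` along `A τ(δ)`.
[cite: JacquetLanglands1970, §5 Thm. 5.13] -/
theorem RealDiscPlus.radial {v : archGardingSpace hcpt τ} {k μ : ℂ} (h : RealDiscPlus hτ w v k μ) :
    (∀ y : ℝ, ℓ (A[y] v) = 0) ∧
      ∃ c : ℂ, ∀ y : ℝ, ℓ (A[y] (gardingAct hτ δ v)) =
        c * (((Real.exp y : ℝ) : ℂ) ^ ((μ + k) / 2) * Complex.exp (-((2 * Real.pi : ℝ) : ℂ) * Real.exp y)) := by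
  obtain ⟨hτb, hℓ, hθ, -, hIθ, -, ha⟩ := realPlace_hyps w hτu hℓW
  have hL : ∀ y : ℝ, ℓ (A[y] (Lo v)) = 0 := fun y => by rw [h.lowering, map_zero, map_zero]
  have hLδ : ∀ y : ℝ, ℓ (A[y] (gardingAct hτ δ (Lo v))) = 0 := fun y => by rw [h.lowering, map_zero, map_zero, map_zero]
  obtain ⟨h0, C, hC⟩ := realShape_discrete hτ w hδ hτb hℓ hθ ha hIθ k μ v h.weyl h.centre hL hLδ
  refine ⟨h0, C, fun y => ?_⟩
  rw [hC y, ofReal_exp_cpow, ← Complex.exp_add]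

/-- **Radial function of the lower discrete type**: `C e^{(μ+k)y/2} e^{-2πe^y}` along `A`, `0` along `A τ(δ)`.
[cite: JacquetLanglands1970, §5 Thm. 5.13] -/
theorem RealDiscMinus.radial {v : archGardingSpace hcpt τ} {k μ : ℂ} (h : RealDiscMinus hτ w v k μ) :
    (∃ c : ℂ, ∀ y : ℝ, ℓ (A[y] v) = c * (((Real.exp y : ℝ) : ℂ) ^ ((μ + k) / 2) * Complex.exp (-((2 * Real.pi : ℝ) : ℂ) * Real.exp y))) ∧
      ∀ y : ℝ, ℓ (A[y] (gardingAct hτ δ v)) = 0 := by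
  obtain ⟨hτb, hℓ, hθ, hθi, hIθ, -, -⟩ := realPlace_hyps w hτu hℓW
  refine ⟨?_, fun y => ?_⟩
  · have hR : ∀ y : ℝ, ℓ (A[y] (Ra v)) = 0 := fun y => by rw [h.raising, map_zero, map_zero]
    obtain ⟨C, hC⟩ := exists_apply_gardingAct_expGL_eq_of_raising_mod hτ w hℓ hθ (-k) μ v h.weyl h.centre hR
    refine ⟨C, fun y => ?_⟩
    rw [hC y, hIθ, ofReal_exp_cpow, ← Complex.exp_add]
    ring_nf
  · -- `τ(δ) v` has weight `k` and is killed by the lowering operator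
    have hW' := realSign_weight hτ hδ h.weyl
    rw [neg_neg] at hW'
    have hZ' := realSign_central hτ hδ h.centre
    have hL' : ∀ y : ℝ, ℓ (A[y] (Lo (gardingAct hτ δ v))) = 0 := fun y => by
      have h1 := realSign_raising hτ hδ (v := v) (by
        have h2 := h.raising
        rwa [LinearMap.add_apply, LinearMap.smul_apply] at h2)
      rw [LinearMap.sub_apply, LinearMap.smul_apply, h1, map_zero, map_zero]
    exact apply_gardingAct_expGL_eq_zero_of_lowering_mod hτ w hτb hℓ hθ hθi k μ _ hW' hZ' hL' y

/-- **Radial function of the symmetrised weight-one type**: `c Φ(e^y)` along `A` with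
`Φ(x) = x^{(μ+1)/2} k_{i(κ-1/2)}(x)`, and `τ(δ) v = η v`. [cite: JacquetLanglands1970, §5 Thm. 5.13] -/
theorem RealWeightOneSym.radial {v : archGardingSpace hcpt τ} {η κ μ lam : ℂ} (h : RealWeightOneSym hτ w δ v η κ μ lam) :
    gardingAct hτ δ v = η • v ∧
      ∃ c : ℂ, ∀ y : ℝ, ℓ (A[y] v) =
        c * (((Real.exp y : ℝ) : ℂ) ^ ((μ + 1) / 2) * besselMode (2 * Real.pi) (Complex.I * (κ - 1 / 2)) (Real.exp y)) := by
  obtain ⟨hτb, hℓ, hθ, -, -, hθa, ha⟩ := realPlace_hyps w hτu hℓW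
  obtain ⟨v', hW, hZ, hC, rfl⟩ := h.exists_inner
  have hδδ := gardingAct_realSign_mul_self hτ hδ
  have hη2 : η * η = 1 := by rcases h.eta with h1 | h1 <;> rw [h1] <;> norm_num
  refine ⟨?_, ?_⟩
  · set y₀ : archGardingSpace hcpt τ := v' + (1 / (2 * κ)) • Lo v' with hy₀
    clear_value y₀
    rw [map_add, map_smul, ← Module.End.mul_apply, hδδ, Module.End.one_apply, smul_add, smul_smul, hη2, one_smul, add_comm]
  -- the combination for `ℓ` and for `ℓ ∘ τ(δ)`
  obtain ⟨c₁, hc₁⟩ := exists_weightOne_combination_eq_besselMode hτ w hτb hℓ hθ ha hθa μ lam κ h.kappa_sq h.kappa_ne v' hW hZ hC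
  have hℓ' := exists_seminormBound_comp_gardingAct hτ hτb hℓ δ
  have hθ' : ∀ u : archGardingSpace hcpt τ, (ℓ ∘ₗ gardingAct hτ δ) (D X⁺ u) =
      -archWhittakerDChar K (0 : Fin 2) 1 ((Pi.single w 1, 0) : mixedSpace K) * (ℓ ∘ₗ gardingAct hτ δ) u :=
    fun u => apply_gardingAct_realSign_gardingEnd_xPlus hτ w hδ hθ u
  have hθa' : (-archWhittakerDChar K (0 : Fin 2) 1 ((Pi.single w 1, 0) : mixedSpace K)) ^ 2 = -(((2 * Real.pi : ℝ) : ℂ) ^ 2) := by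
    rw [neg_sq, hθa]
  obtain ⟨c₂, hc₂⟩ := exists_weightOne_combination_eq_besselMode hτ w hτb (ℓ := ℓ ∘ₗ gardingAct hτ δ)
    (by simpa only [LinearMap.coe_comp, Function.comp_apply] using hℓ') hθ' ha hθa' μ lam κ h.kappa_sq h.kappa_ne v' hW hZ hC
  refine ⟨c₁ + η * c₂, fun y => ?_⟩
  have e : A[y] ((v' + (1 / (2 * κ)) • Lo v') + η • gardingAct hτ δ (v' + (1 / (2 * κ)) • Lo v')) =
      A[y] (v' + (1 / (2 * κ)) • Lo v') + η • gardingAct hτ δ (A[y] (v' + (1 / (2 * κ)) • Lo v')) := by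
    rw [map_add, map_smul, ← Module.End.mul_apply (A[y]) (gardingAct hτ δ), gardingAct_expGL_mul_realSign hτ hδ, Module.End.mul_apply]
  have h1 : ℓ (A[y] (v' + (1 / (2 * κ)) • Lo v')) = ℓ (A[y] v') + 1 / (2 * κ) * ℓ (A[y] (Lo v')) := by
    rw [map_add, map_smul, map_add, map_smul, smul_eq_mul]
  have h2 : ℓ (gardingAct hτ δ (A[y] (v' + (1 / (2 * κ)) • Lo v'))) =
      (ℓ ∘ₗ gardingAct hτ δ) (A[y] v') + 1 / (2 * κ) * (ℓ ∘ₗ gardingAct hτ δ) (A[y] (Lo v')) := by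
    rw [map_add, map_smul, map_add, map_smul, map_add, map_smul, smul_eq_mul, LinearMap.coe_comp, Function.comp_apply,
      Function.comp_apply]
  rw [e, map_add, map_smul, h1, h2, hc₁ y, hc₂ y, smul_eq_mul]
  ring

/-- **Radial function of the weight-zero type**: `c Φ(e^y)` along `A` with `Φ(x) = x^{μ/2} k_ν(x)`,
`λ = μ²/2 - 2ν² - ½`, and `τ(δ) v = ε v`. [cite: JacquetLanglands1970, §5 Thm. 5.13] -/
theorem RealWeightZero.radial {v : archGardingSpace hcpt τ} {ε μ lam : ℂ} (h : RealWeightZero hτ w δ v ε μ lam)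
    (ν : ℂ) (hlam : lam = μ ^ 2 / 2 - 2 * ν ^ 2 - 1 / 2) :
    gardingAct hτ δ v = ε • v ∧
      ∃ c : ℂ, ∀ y : ℝ, ℓ (A[y] v) = c * (((Real.exp y : ℝ) : ℂ) ^ (μ / 2) * besselMode (2 * Real.pi) ν (Real.exp y)) := by
  obtain ⟨hτb, hℓ, hθ, -, -, hθa, ha⟩ := realPlace_hyps w hτu hℓW
  obtain ⟨c, hc⟩ := (realShape_weightZero hτ w hδ hτb hℓ hθ ha hθa μ lam ν hlam v h.weyl h.centre h.casimir).1
  exact ⟨h.sign, c, fun y => by rw [hc y, mul_assoc]⟩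

omit hδ in
/-- **Radial function of the modified weight-zero type**: `c Φ(e^y)` along `A` with `Φ(x) = x^{μ/2+1} k_ν(x)`,
and `τ(δ) v = ε v`. [cite: JacquetLanglands1970, §5 Thm. 5.13] -/
theorem RealWeightZeroX.radial {v : archGardingSpace hcpt τ} {ε μ lam : ℂ} (h : RealWeightZeroX hτ w δ v ε μ lam)
    (hδ : (δ : Matrix (Fin 2) (Fin 2) (mixedSpace K)) = 1 - (2 : ℝ) • Matrix.single (0 : Fin 2) (0 : Fin 2) ((Pi.single w 1, 0) : mixedSpace K))
    (ν : ℂ) (hlam : lam = μ ^ 2 / 2 - 2 * ν ^ 2 - 1 / 2) :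
    gardingAct hτ δ v = ε • v ∧
      ∃ c : ℂ, ∀ y : ℝ, ℓ (A[y] v) = c * (((Real.exp y : ℝ) : ℂ) ^ (μ / 2 + 1) * besselMode (2 * Real.pi) ν (Real.exp y)) := by
  obtain ⟨hτb, hℓ, hθ, -, -, hθa, ha⟩ := realPlace_hyps w hτu hℓW
  obtain ⟨v', hW, hZ, hC, hsign, rfl⟩ := h.exists_inner
  refine ⟨?_, ?_⟩
  · obtain ⟨-, -, h3, h4⟩ := gardingAct_realSign_mul_letters hτ hδ
    rw [gardingEnd_add, LinearMap.add_apply, map_add, ← Module.End.mul_apply, ← Module.End.mul_apply, h3, h4,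
      LinearMap.smul_apply, LinearMap.smul_apply, Module.End.mul_apply, Module.End.mul_apply, hsign, map_smul, map_smul,
      smul_add, smul_smul, smul_smul]
    congr 1 <;> congr 1 <;> ring
  · obtain ⟨c, hc⟩ := (realShape_weightZero hτ w hδ hτb hℓ hθ ha hθa μ lam ν hlam v' hW hZ hC).1
    refine ⟨2 * archWhittakerDChar K (0 : Fin 2) 1 ((Pi.single w 1, 0) : mixedSpace K) * c, fun y => ?_⟩
    rw [(apply_gardingAct_expGL_xSum_of_weightZero hτ w hθ v' hW y).2, hc y,
      show μ / 2 + 1 = μ / 2 + ((1 : ℕ) : ℂ) by norm_num, ← ofReal_exp_cpow_mul_pow, pow_one]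
    ring

end Shapes

/-! #### From the radial form to the Kirillov function on `ℝˣ` -/

section Units

variable {ℓ : archGardingSpace hcpt τ →ₗ[ℂ] ℂ}

/-- `τ(diag(ι_w(t),1)) = τ(exp((log t) H₀))` for `t > 0`. [folklore] -/
theorem gardingAct_diagGL2_realUnitAt_of_pos (v : archGardingSpace hcpt τ) {t : ℝˣ} (ht : 0 < (t : ℝ)) :
    gardingAct hτ (diagGL2 (realUnitAt K w t) 1) v = A[Real.log t] v := by
  rw [diagGL2_realUnitAt_of_pos w ht]

include hδ

/-- `τ(diag(ι_w(t),1)) = τ(exp((log |t|) H₀)) τ(δ_w)` for `t < 0`. [folklore] -/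
theorem gardingAct_diagGL2_realUnitAt_of_neg (v : archGardingSpace hcpt τ) {t : ℝˣ} (ht : (t : ℝ) < 0) :
    gardingAct hτ (diagGL2 (realUnitAt K w t) 1) v = A[Real.log |(t : ℝ)|] (gardingAct hτ δ v) := by
  rw [diagGL2_realUnitAt_of_neg hδ ht, gardingAct_mul, Module.End.mul_apply]

/-- **From the radial form to `ℝˣ`**: if `ℓ(τ(e^{yH₀}) v) = c c₊ Φ(e^y)` and `ℓ(τ(e^{yH₀}) τ(δ) v) = c c₋ Φ(e^y)` and
`F(t) = c₊ Φ(t)` (`t > 0`), `c₋ Φ(-t)` (`t < 0`), then `ℓ(τ(diag(ι_w(t),1)) v) = c F(t)` on `ℝˣ`. [folklore] -/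
theorem kirillov_eq_const_mul_of_radial {v : archGardingSpace hcpt τ} {Φ F : ℝ → ℂ} {c cp cm : ℂ}
    (hFp : ∀ t : ℝ, 0 < t → F t = cp * Φ t) (hFm : ∀ t : ℝ, t < 0 → F t = cm * Φ (-t))
    (hp : ∀ y : ℝ, ℓ (A[y] v) = c * cp * Φ (Real.exp y)) (hm : ∀ y : ℝ, ℓ (A[y] (gardingAct hτ δ v)) = c * cm * Φ (Real.exp y))
    (t : ℝˣ) : ℓ (gardingAct hτ (diagGL2 (realUnitAt K w t) 1) v) = c * F t := by
  rcases lt_or_gt_of_ne t.ne_zero with ht | ht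
  · rw [gardingAct_diagGL2_realUnitAt_of_neg w hδ v ht, hm, Real.exp_log (abs_pos.mpr t.ne_zero), hFm _ ht, abs_of_neg ht]
    ring
  · rw [gardingAct_diagGL2_realUnitAt_of_pos w v ht, hp, Real.exp_log ht, hFp _ ht]
    ring

variable (hτu : τ.IsUnitary) (hℓW : IsArchContWhittakerFunctional hcpt τ hτ ℓ)
include hτu hℓW

/-- **Kirillov function of the upper discrete type** against any `F` with `F = 0` on `t > 0` and
`F(t) = |t|^{(μ+k)/2} e^{-2π|t|}` on `t < 0`. [cite: JacquetLanglands1970, §5 Thm. 5.13, 5.15] -/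
theorem RealDiscPlus.kirillov {v : archGardingSpace hcpt τ} {k μ : ℂ} (h : RealDiscPlus hτ w v k μ) {F : ℝ → ℂ}
    (hFp : ∀ t : ℝ, 0 < t → F t = 0)
    (hFm : ∀ t : ℝ, t < 0 → F t = (((-t : ℝ)) : ℂ) ^ ((μ + k) / 2) * Complex.exp (-((2 * Real.pi : ℝ) : ℂ) * ((-t : ℝ) : ℂ))) :
    ∃ c : ℂ, ∀ t : ℝˣ, ℓ (gardingAct hτ (diagGL2 (realUnitAt K w t) 1) v) = c * F t := by
  obtain ⟨h0, c, hc⟩ := h.radial w hδ hτu hℓW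
  refine ⟨c, kirillov_eq_const_mul_of_radial w hδ (Φ := fun x : ℝ => (x : ℂ) ^ ((μ + k) / 2) * Complex.exp (-((2 * Real.pi : ℝ) : ℂ) * x))
    (cp := 0) (cm := 1) (fun t ht => by rw [hFp t ht, zero_mul]) (fun t ht => by rw [hFm t ht, one_mul]) (fun y => by rw [h0 y]; ring)
    (fun y => by rw [hc y]; ring)⟩

/-- **Kirillov function of the lower discrete type.** [cite: JacquetLanglands1970, §5 Thm. 5.13, 5.15] -/
theorem RealDiscMinus.kirillov {v : archGardingSpace hcpt τ} {k μ : ℂ} (h : RealDiscMinus hτ w v k μ) {F : ℝ → ℂ}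
    (hFp : ∀ t : ℝ, 0 < t → F t = ((t : ℝ) : ℂ) ^ ((μ + k) / 2) * Complex.exp (-((2 * Real.pi : ℝ) : ℂ) * (t : ℂ)))
    (hFm : ∀ t : ℝ, t < 0 → F t = 0) :
    ∃ c : ℂ, ∀ t : ℝˣ, ℓ (gardingAct hτ (diagGL2 (realUnitAt K w t) 1) v) = c * F t := by
  obtain ⟨⟨c, hc⟩, h0⟩ := h.radial w hδ hτu hℓW
  refine ⟨c, kirillov_eq_const_mul_of_radial w hδ (Φ := fun x : ℝ => (x : ℂ) ^ ((μ + k) / 2) * Complex.exp (-((2 * Real.pi : ℝ) : ℂ) * x))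
    (cp := 1) (cm := 0) (fun t ht => by rw [hFp t ht, one_mul]) (fun t ht => by rw [hFm t ht, zero_mul]) (fun y => by rw [hc y]; ring)
    (fun y => by rw [h0 y]; ring)⟩

/-- **Kirillov function of the symmetrised weight-one type.** [cite: JacquetLanglands1970, §5 Thm. 5.13, 5.15] -/
theorem RealWeightOneSym.kirillov {v : archGardingSpace hcpt τ} {η κ μ lam : ℂ} (h : RealWeightOneSym hτ w δ v η κ μ lam) {F : ℝ → ℂ}
    (hFp : ∀ t : ℝ, 0 < t → F t = ((t : ℝ) : ℂ) ^ ((μ + 1) / 2) * besselMode (2 * Real.pi) (Complex.I * (κ - 1 / 2)) t)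
    (hFm : ∀ t : ℝ, t < 0 → F t = η * ((((-t : ℝ)) : ℂ) ^ ((μ + 1) / 2) * besselMode (2 * Real.pi) (Complex.I * (κ - 1 / 2)) (-t))) :
    ∃ c : ℂ, ∀ t : ℝˣ, ℓ (gardingAct hτ (diagGL2 (realUnitAt K w t) 1) v) = c * F t := by
  obtain ⟨hsign, c, hc⟩ := h.radial w hδ hτu hℓW
  refine ⟨c, kirillov_eq_const_mul_of_radial w hδ
    (Φ := fun x : ℝ => (x : ℂ) ^ ((μ + 1) / 2) * besselMode (2 * Real.pi) (Complex.I * (κ - 1 / 2)) x)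
    (cp := 1) (cm := η) (fun t ht => by rw [hFp t ht, one_mul]) (fun t ht => by rw [hFm t ht]) (fun y => by rw [hc y]; ring)
    (fun y => by rw [hsign, map_smul, map_smul, smul_eq_mul, hc y]; ring)⟩

/-- **Kirillov function of the weight-zero type.** [cite: JacquetLanglands1970, §5 Thm. 5.13, 5.15] -/
theorem RealWeightZero.kirillov {v : archGardingSpace hcpt τ} {ε μ lam : ℂ} (h : RealWeightZero hτ w δ v ε μ lam)
    (ν : ℂ) (hlam : lam = μ ^ 2 / 2 - 2 * ν ^ 2 - 1 / 2) {F : ℝ → ℂ}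
    (hFp : ∀ t : ℝ, 0 < t → F t = ((t : ℝ) : ℂ) ^ (μ / 2) * besselMode (2 * Real.pi) ν t)
    (hFm : ∀ t : ℝ, t < 0 → F t = ε * ((((-t : ℝ)) : ℂ) ^ (μ / 2) * besselMode (2 * Real.pi) ν (-t))) :
    ∃ c : ℂ, ∀ t : ℝˣ, ℓ (gardingAct hτ (diagGL2 (realUnitAt K w t) 1) v) = c * F t := by
  obtain ⟨hsign, c, hc⟩ := h.radial w hδ hτu hℓW ν hlam
  refine ⟨c, kirillov_eq_const_mul_of_radial w hδ (Φ := fun x : ℝ => (x : ℂ) ^ (μ / 2) * besselMode (2 * Real.pi) ν x)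
    (cp := 1) (cm := ε) (fun t ht => by rw [hFp t ht, one_mul]) (fun t ht => by rw [hFm t ht]) (fun y => by rw [hc y]; ring)
    (fun y => by rw [hsign, map_smul, map_smul, smul_eq_mul, hc y]; ring)⟩

/-- **Kirillov function of the modified weight-zero type.** [cite: JacquetLanglands1970, §5 Thm. 5.13, 5.15] -/
theorem RealWeightZeroX.kirillov {v : archGardingSpace hcpt τ} {ε μ lam : ℂ} (h : RealWeightZeroX hτ w δ v ε μ lam)
    (ν : ℂ) (hlam : lam = μ ^ 2 / 2 - 2 * ν ^ 2 - 1 / 2) {F : ℝ → ℂ}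
    (hFp : ∀ t : ℝ, 0 < t → F t = ((t : ℝ) : ℂ) ^ (μ / 2 + 1) * besselMode (2 * Real.pi) ν t)
    (hFm : ∀ t : ℝ, t < 0 → F t = ε * ((((-t : ℝ)) : ℂ) ^ (μ / 2 + 1) * besselMode (2 * Real.pi) ν (-t))) :
    ∃ c : ℂ, ∀ t : ℝˣ, ℓ (gardingAct hτ (diagGL2 (realUnitAt K w t) 1) v) = c * F t := by
  obtain ⟨hsign, c, hc⟩ := h.radial w hτu hℓW hδ ν hlam
  refine ⟨c, kirillov_eq_const_mul_of_radial w hδ (Φ := fun x : ℝ => (x : ℂ) ^ (μ / 2 + 1) * besselMode (2 * Real.pi) ν x)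
    (cp := 1) (cm := ε) (fun t ht => by rw [hFp t ht, one_mul]) (fun t ht => by rw [hFm t ht]) (fun y => by rw [hc y]; ring)
    (fun y => by rw [hsign, map_smul, map_smul, smul_eq_mul, hc y]; ring)⟩

end Units

/-! #### Transport of the real types by commuting operators -/

section Transport

variable {Φ : Module.End ℂ (archGardingSpace hcpt τ)}
  (hΦ : ∀ i j : Fin 2, Commute Φ (gardingEnd hτ (Matrix.single i j ((Pi.single w 1, 0) : mixedSpace K))))

include hΦ

/-- An operator commuting with the place-`w` letters commutes with `τ(X⁺-X⁻)`, `τ(H₀)+τ(H₁)`, `τ(X⁺+X⁻)` and the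
Casimir. [folklore] -/
theorem commute_realPlace_ops :
    Commute Φ (D (X⁺ - X⁻)) ∧ Commute Φ (D H₀ + D H₁) ∧ Commute Φ (D (X⁺ + X⁻)) ∧
      ∀ v : archGardingSpace hcpt τ,
        ∑ i : Fin 2, ∑ j : Fin 2, D (Matrix.single i j ((Pi.single w 1, 0) : mixedSpace K))
            (D (Matrix.single j i ((Pi.single w 1, 0) : mixedSpace K)) (Φ v)) =
          Φ (∑ i : Fin 2, ∑ j : Fin 2, D (Matrix.single i j ((Pi.single w 1, 0) : mixedSpace K))
            (D (Matrix.single j i ((Pi.single w 1, 0) : mixedSpace K)) v)) := by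
  refine ⟨?_, (hΦ 0 0).add_right (hΦ 1 1), ?_, fun v => ?_⟩
  · rw [gardingEnd_sub]; exact (hΦ 0 1).sub_right (hΦ 1 0)
  · rw [gardingEnd_add]; exact (hΦ 0 1).add_right (hΦ 1 0)
  · rw [_root_.map_sum]
    refine Finset.sum_congr rfl fun i _ => ?_
    rw [_root_.map_sum]
    refine Finset.sum_congr rfl fun j _ => ?_
    have h1 := congrArg (fun T => T v) (hΦ j i).eq
    have h2 := congrArg (fun T => T (gardingEnd hτ (Matrix.single j i ((Pi.single w 1, 0) : mixedSpace K)) v)) (hΦ i j).eq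
    simp only [Module.End.mul_apply] at h1 h2
    rw [← h1, ← h2]

/-- Transport of `RealDiscPlus`. [folklore] -/
theorem RealDiscPlus.map {v : archGardingSpace hcpt τ} {k μ : ℂ} (h : RealDiscPlus hτ w v k μ) : RealDiscPlus hτ w (Φ v) k μ := by
  obtain ⟨hW, hZ, -, -⟩ := commute_realPlace_ops w hΦ
  obtain ⟨-, hLo, -⟩ := commute_weylR_lowering_raising hτ w hΦ
  refine ⟨?_, ?_, ?_⟩
  · rw [← Module.End.mul_apply, ← hW.eq, Module.End.mul_apply, h.weyl, map_smul]
  · rw [← LinearMap.add_apply, ← Module.End.mul_apply, ← hZ.eq, Module.End.mul_apply, LinearMap.add_apply, h.centre, map_smul]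
  · rw [← Module.End.mul_apply, ← hLo.eq, Module.End.mul_apply, h.lowering, map_zero]

/-- Transport of `RealDiscMinus`. [folklore] -/
theorem RealDiscMinus.map {v : archGardingSpace hcpt τ} {k μ : ℂ} (h : RealDiscMinus hτ w v k μ) : RealDiscMinus hτ w (Φ v) k μ := by
  obtain ⟨hW, hZ, -, -⟩ := commute_realPlace_ops w hΦ
  obtain ⟨-, -, hRa⟩ := commute_weylR_lowering_raising hτ w hΦ
  refine ⟨?_, ?_, ?_⟩
  · rw [← Module.End.mul_apply, ← hW.eq, Module.End.mul_apply, h.weyl, map_smul]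
  · rw [← LinearMap.add_apply, ← Module.End.mul_apply, ← hZ.eq, Module.End.mul_apply, LinearMap.add_apply, h.centre, map_smul]
  · rw [← Module.End.mul_apply, ← hRa.eq, Module.End.mul_apply, h.raising, map_zero]

variable (hΦδ : Commute Φ (gardingAct hτ δ))
include hΦδ

/-- Transport of `RealWeightOneSym`. [folklore] -/
theorem RealWeightOneSym.map {v : archGardingSpace hcpt τ} {η κ μ lam : ℂ} (h : RealWeightOneSym hτ w δ v η κ μ lam) :
    RealWeightOneSym hτ w δ (Φ v) η κ μ lam := by
  obtain ⟨hW, hZ, -, hCas⟩ := commute_realPlace_ops w hΦ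
  obtain ⟨-, hLo, -⟩ := commute_weylR_lowering_raising hτ w hΦ
  obtain ⟨v', hW', hZ', hC', rfl⟩ := h.exists_inner
  refine ⟨h.eta, h.kappa_sq, h.kappa_ne, Φ v', ?_, ?_, ?_, ?_⟩
  · rw [← Module.End.mul_apply, ← hW.eq, Module.End.mul_apply, hW', map_smul]
  · rw [← LinearMap.add_apply, ← Module.End.mul_apply, ← hZ.eq, Module.End.mul_apply, LinearMap.add_apply, hZ', map_smul]
  · rw [hCas, hC', map_smul]
  · rw [map_add, map_smul, ← Module.End.mul_apply Φ (gardingAct hτ δ), hΦδ.eq, Module.End.mul_apply, map_add, map_smul,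
      ← Module.End.mul_apply Φ, hLo.eq, Module.End.mul_apply]

/-- Transport of `RealWeightZero`. [folklore] -/
theorem RealWeightZero.map {v : archGardingSpace hcpt τ} {ε μ lam : ℂ} (h : RealWeightZero hτ w δ v ε μ lam) :
    RealWeightZero hτ w δ (Φ v) ε μ lam := by
  obtain ⟨hW, hZ, -, hCas⟩ := commute_realPlace_ops w hΦ
  refine ⟨h.eps, ?_, ?_, ?_, ?_⟩
  · rw [← Module.End.mul_apply, ← hW.eq, Module.End.mul_apply, h.weyl, map_zero]
  · rw [← LinearMap.add_apply, ← Module.End.mul_apply, ← hZ.eq, Module.End.mul_apply, LinearMap.add_apply, h.centre, map_smul]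
  · rw [hCas, h.casimir, map_smul]
  · rw [← Module.End.mul_apply, ← hΦδ.eq, Module.End.mul_apply, h.sign, map_smul]

/-- Transport of `RealWeightZeroX`. [folklore] -/
theorem RealWeightZeroX.map {v : archGardingSpace hcpt τ} {ε μ lam : ℂ} (h : RealWeightZeroX hτ w δ v ε μ lam) :
    RealWeightZeroX hτ w δ (Φ v) ε μ lam := by
  obtain ⟨hW, hZ, hX, hCas⟩ := commute_realPlace_ops w hΦ
  obtain ⟨v', hW', hZ', hC', hsign, rfl⟩ := h.exists_inner
  refine ⟨h.eps, Φ v', ?_, ?_, ?_, ?_, ?_⟩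
  · rw [← Module.End.mul_apply, ← hW.eq, Module.End.mul_apply, hW', map_zero]
  · rw [← LinearMap.add_apply, ← Module.End.mul_apply, ← hZ.eq, Module.End.mul_apply, LinearMap.add_apply, hZ', map_smul]
  · rw [hCas, hC', map_smul]
  · rw [← Module.End.mul_apply, ← hΦδ.eq, Module.End.mul_apply, hsign, map_smul]
  · rw [← Module.End.mul_apply, hX.eq, Module.End.mul_apply]

end Transport

/-! #### The commuting operators: torus translations and the letters of the other places -/

section Commuting

/-- `τ(diag(u',1))` commutes with the place-`w` letters when `u'_w = 1`. [folklore] -/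
theorem commute_gardingAct_diagGL2_letters {u' : (mixedSpace K)ˣ} (hu' : (u' : mixedSpace K).1 w = 1) (i j : Fin 2) :
    Commute (gardingAct hτ (diagGL2 u' 1)) (D (Matrix.single i j ((Pi.single w 1, 0) : mixedSpace K))) := by
  change gardingAct hτ (diagGL2 u' 1) * D (Matrix.single i j ((Pi.single w 1, 0) : mixedSpace K)) =
    D (Matrix.single i j ((Pi.single w 1, 0) : mixedSpace K)) * gardingAct hτ (diagGL2 u' 1)
  rw [gardingAct_mul_gardingEnd, conj_single_realIdem_eq w u' hu']

include hδ in
/-- `τ(diag(u',1))` commutes with `τ(δ_w)`. [folklore] -/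
theorem commute_gardingAct_diagGL2_realSign (u' : (mixedSpace K)ˣ) : Commute (gardingAct hτ (diagGL2 u' 1)) (gardingAct hτ δ) := by
  change gardingAct hτ (diagGL2 u' 1) * gardingAct hτ δ = gardingAct hτ δ * gardingAct hτ (diagGL2 u' 1)
  rw [← gardingAct_mul, ← gardingAct_mul, realSign_eq_diagGL2 hδ, diagGL2_one_comm]

end Commuting

end RealPlace

/-! ### 3. Complex places -/

section ComplexPlace

variable {hcpt : isCompact_glFiniteIntegralLevel 2 K}
  {E : Type*} [NormedAddCommGroup E] [InnerProductSpace ℂ E] [CompleteSpace E]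
  {τ : ContRepresentation ℂ (AutomorphyDatum.gl 2 K hcpt).arch.carrier E}
  (hτ : τ.IsStronglyContinuous) (w : {w : InfinitePlace K // IsComplex w})

local notation "𝐜" => ((0, Pi.single w 1) : mixedSpace K)
local notation "𝐜I" => ((0, Pi.single w Complex.I) : mixedSpace K)
local notation "Hc" => Matrix.single (0 : Fin 2) (0 : Fin 2) ((0, Pi.single w 1) : mixedSpace K)
local notation "D" => gardingEnd (hcpt := hcpt) (τ := τ) hτ
local notation "A[" y "]" => gardingAct (hcpt := hcpt) (τ := τ) hτ (expGL ((y : ℝ) • Hc))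
local notation "Dh[" i "," j "]" => (gardingEnd (hcpt := hcpt) (τ := τ) hτ (Matrix.single (i : Fin 2) (j : Fin 2) ((0, Pi.single w 1) : mixedSpace K)) -
  Complex.I • gardingEnd (hcpt := hcpt) (τ := τ) hτ (Matrix.single (i : Fin 2) (j : Fin 2) ((0, Pi.single w Complex.I) : mixedSpace K)))
local notation "Da[" i "," j "]" => (gardingEnd (hcpt := hcpt) (τ := τ) hτ (Matrix.single (i : Fin 2) (j : Fin 2) ((0, Pi.single w 1) : mixedSpace K)) +
  Complex.I • gardingEnd (hcpt := hcpt) (τ := τ) hτ (Matrix.single (i : Fin 2) (j : Fin 2) ((0, Pi.single w Complex.I) : mixedSpace K)))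
local notation "Tc" => (Matrix.single (0 : Fin 2) (0 : Fin 2) ((0, Pi.single w Complex.I) : mixedSpace K) -
  Matrix.single (1 : Fin 2) (1 : Fin 2) ((0, Pi.single w Complex.I) : mixedSpace K))
local notation "Zc" => (Matrix.single (0 : Fin 2) (0 : Fin 2) ((0, Pi.single w Complex.I) : mixedSpace K) +
  Matrix.single (1 : Fin 2) (1 : Fin 2) ((0, Pi.single w Complex.I) : mixedSpace K))
local notation "Rc" => gardingAct (hcpt := hcpt) (τ := τ) hτ
  (expGL ((Real.pi / 2 : ℝ) • (Matrix.single (0 : Fin 2) (1 : Fin 2) ((0, Pi.single w 1) : mixedSpace K) -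
    Matrix.single (1 : Fin 2) (0 : Fin 2) ((0, Pi.single w 1) : mixedSpace K))))

/-- **Inner data of a complex type**: `y` is highest (`E_w y = 0`) of torus weight `im`, the string below it has
length `m + 1`, and the Weyl rotation `exp((π/2)(E₀₁ - E₁₀) ⊗ c_w)` maps `y` to a NON-ZERO multiple of the
lowest vector `F_w^m y` (as it must in the `(m+1)`-dimensional representation of `SU(2)`).
[cite: JacquetLanglands1970, §6 Thm. 6.2] -/
def ComplexInner (y : archGardingSpace hcpt τ) (m : ℕ) : Prop :=
  (Dh[0,1] - Da[1,0]) y = 0 ∧ D Tc y = (Complex.I * m) • y ∧ ((Dh[1,0] - Da[0,1]) ^ (m + 1)) y = 0 ∧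
    ∃ c : ℂ, c ≠ 0 ∧ Rc y = c • ((Dh[1,0] - Da[0,1]) ^ m) y

/-- **Holomorphic-power type**: `v = τ^h(E₀₁)^b y` with `y` highest (`E_w y = 0`) of torus weight `im`.
[cite: JacquetLanglands1970, §6 Thm. 6.2] -/
structure ComplexHolPow (v : archGardingSpace hcpt τ) (b m : ℕ) : Prop where
  exists_inner : ∃ y : archGardingSpace hcpt τ, ComplexInner hτ w y m ∧ v = (Dh[0,1] ^ b) y

/-- **Antiholomorphic-power-of-lowest type**: `v = τ^a(E₀₁)^b F^m y` with `y` highest of torus weight `im` and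
`F^{m+1} y = 0`. [cite: JacquetLanglands1970, §6 Thm. 6.2] -/
structure ComplexAntiPowLowest (v : archGardingSpace hcpt τ) (b m : ℕ) : Prop where
  exists_inner : ∃ y : archGardingSpace hcpt τ, ComplexInner hτ w y m ∧ v = (Da[0,1] ^ b) (((Dh[1,0] - Da[0,1]) ^ m) y)

/-- **String type**: `v = F^j y` with `y` highest of torus weight `im`. [cite: JacquetLanglands1970, §6 Thm. 6.2] -/
structure ComplexString (v : archGardingSpace hcpt τ) (j m : ℕ) : Prop where
  le : j ≤ m
  exists_inner : ∃ y : archGardingSpace hcpt τ, ComplexInner hτ w y m ∧ v = ((Dh[1,0] - Da[0,1]) ^ j) y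

variable {hτ}

section Shapes

variable (hτu : τ.IsUnitary) {ℓ : archGardingSpace hcpt τ →ₗ[ℂ] ℂ} (hℓW : IsArchContWhittakerFunctional hcpt τ hτ ℓ)
include hτu hℓW

/-- The standing analytic hypotheses at a complex place for the actual `τ`, `ℓ`. [folklore] -/
theorem complexPlace_hyps :
    (∀ g, ‖(τ g : E →L[ℂ] E)‖ ≤ 1) ∧
    (∃ (C : ℝ) (𝒮 : Finset (List (Matrix (Fin 2) (Fin 2) (mixedSpace K)))), 0 ≤ C ∧
      ∀ v : archGardingSpace hcpt τ, ‖ℓ v‖ ≤ C * ∑ w ∈ 𝒮, ‖archWordDerivE hcpt τ w v‖) ∧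
    (∀ u : archGardingSpace hcpt τ, ℓ (D (Matrix.single 0 1 𝐜) u) = archWhittakerDChar K (0 : Fin 2) 1 𝐜 * ℓ u) ∧
    (∀ u : archGardingSpace hcpt τ, ℓ (D (Matrix.single 0 1 𝐜I) u) = archWhittakerDChar K (0 : Fin 2) 1 𝐜I * ℓ u) ∧
    (0 : ℝ) < 4 * Real.pi ∧
    (archWhittakerDChar K (0 : Fin 2) 1 𝐜 + Complex.I * archWhittakerDChar K (0 : Fin 2) 1 𝐜I) *
        (archWhittakerDChar K (0 : Fin 2) 1 𝐜 - Complex.I * archWhittakerDChar K (0 : Fin 2) 1 𝐜I) = -(((4 * Real.pi : ℝ) : ℂ) ^ 2) :=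
  ⟨norm_apply_le_one_of_isUnitary hτu, hℓW.norm_le, fun u => apply_gardingEnd_single_zero_one hτ hℓW _ u,
    fun u => apply_gardingEnd_single_zero_one hτ hℓW _ u, by positivity, archWhittakerDChar_hol_mul_anti w⟩

/-- **Radial function of the holomorphic-power type**: torus weight `i(m+2b)`, radial function
`c (e^y)^{(μ₁+m+1)/2+b} k_ν(e^y)` (`k = besselMode 4π`, `λ^a = (μ₁+iμ₂)²/2 - 2ν² - 2`). [cite: JacquetLanglands1970, §6 Thm. 6.2] -/
theorem ComplexHolPow.radial {v : archGardingSpace hcpt τ} {b m : ℕ} (h : ComplexHolPow hτ w v b m)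
    (μ₁ μ₂ lama ν : ℂ) (hlama : lama = (μ₁ + Complex.I * μ₂) ^ 2 / 2 - 2 * ν ^ 2 - 2)
    (hZ1 : ∀ v : archGardingSpace hcpt τ, D (Matrix.single 0 0 𝐜 + Matrix.single 1 1 𝐜) v = μ₁ • v)
    (hZ2 : ∀ v : archGardingSpace hcpt τ, D Zc v = μ₂ • v)
    (hCa : ∀ v : archGardingSpace hcpt τ, ∑ i : Fin 2, ∑ j : Fin 2, Da[i,j] (Da[j,i] v) = lama • v) :
    D Tc v = (Complex.I * ((m : ℂ) + 2 * b)) • v ∧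
      ∃ c : ℂ, ∀ y : ℝ, ℓ (A[y] v) = c * (((Real.exp y : ℝ) : ℂ) ^ ((μ₁ + m + 1) / 2 + b) * besselMode (4 * Real.pi) ν (Real.exp y)) := by
  obtain ⟨hτb, hℓ, hθ₁, hθ₂, ha, hθa⟩ := complexPlace_hyps w hτu hℓW
  obtain ⟨x, ⟨hE, hT, -, -⟩, rfl⟩ := h.exists_inner
  obtain ⟨h1, c, hc⟩ := realShapeC_caseA hτ w hτb hℓ hθ₁ hθ₂ ha hθa μ₁ μ₂ m lama ν hlama x hE hT (hZ1 x) hZ2 (hCa x) b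
  exact ⟨h1, c, fun y => by rw [hc y, mul_assoc]⟩

/-- **Radial function of the antiholomorphic-power-of-lowest type**: torus weight `-i(m+2b)`, radial function
`c (e^y)^{(μ₁+m+1)/2+b} k_{ν'}(e^y)` with `λ^h = (μ₁-iμ₂)²/2 - 2ν'² - 2`. [cite: JacquetLanglands1970, §6 Thm. 6.2] -/
theorem ComplexAntiPowLowest.radial {v : archGardingSpace hcpt τ} {b m : ℕ} (h : ComplexAntiPowLowest hτ w v b m)
    (μ₁ μ₂ lamh ν' : ℂ) (hlamh : lamh = (μ₁ - Complex.I * μ₂) ^ 2 / 2 - 2 * ν' ^ 2 - 2)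
    (hZ1 : ∀ v : archGardingSpace hcpt τ, D (Matrix.single 0 0 𝐜 + Matrix.single 1 1 𝐜) v = μ₁ • v)
    (hZ2 : ∀ v : archGardingSpace hcpt τ, D Zc v = μ₂ • v)
    (hCh : ∀ v : archGardingSpace hcpt τ, ∑ i : Fin 2, ∑ j : Fin 2, Dh[i,j] (Dh[j,i] v) = lamh • v) :
    D Tc v = (Complex.I * (-(m : ℂ) - 2 * b)) • v ∧
      ∃ c : ℂ, ∀ y : ℝ, ℓ (A[y] v) = c * (((Real.exp y : ℝ) : ℂ) ^ ((μ₁ + m + 1) / 2 + b) * besselMode (4 * Real.pi) ν' (Real.exp y)) := by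
  obtain ⟨hτb, hℓ, hθ₁, hθ₂, ha, hθa⟩ := complexPlace_hyps w hτu hℓW
  obtain ⟨x, ⟨-, hT, hFm, -⟩, rfl⟩ := h.exists_inner
  obtain ⟨h1, c, hc⟩ := realShapeC_caseB1 hτ w hτb hℓ hθ₁ hθ₂ ha hθa μ₁ μ₂ m lamh ν' hlamh x hT hFm hZ1 hZ2 hCh b
  exact ⟨h1, c, fun y => by rw [hc y, mul_assoc]⟩

/-- **Radial function of the string type** under the minimal-type relation
`λ^h = (μ₁-iμ₂)²/2 - 2(ν-im)² - 2`: torus weight `i(m-2j)`, radial function `c (e^y)^{(μ₁+m+1)/2} k_{ν-ij}(e^y)`.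
[cite: JacquetLanglands1970, §6 Thm. 6.2] -/
theorem ComplexString.radial {v : archGardingSpace hcpt τ} {j m : ℕ} (h : ComplexString hτ w v j m)
    (μ₁ μ₂ lama lamh ν : ℂ) (hlama : lama = (μ₁ + Complex.I * μ₂) ^ 2 / 2 - 2 * ν ^ 2 - 2)
    (hlamh : lamh = (μ₁ - Complex.I * μ₂) ^ 2 / 2 - 2 * (ν - Complex.I * m) ^ 2 - 2)
    (hZ1 : ∀ v : archGardingSpace hcpt τ, D (Matrix.single 0 0 𝐜 + Matrix.single 1 1 𝐜) v = μ₁ • v)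
    (hZ2 : ∀ v : archGardingSpace hcpt τ, D Zc v = μ₂ • v)
    (hCa : ∀ v : archGardingSpace hcpt τ, ∑ i : Fin 2, ∑ j : Fin 2, Da[i,j] (Da[j,i] v) = lama • v)
    (hCh : ∀ v : archGardingSpace hcpt τ, ∑ i : Fin 2, ∑ j : Fin 2, Dh[i,j] (Dh[j,i] v) = lamh • v) :
    D Tc v = (Complex.I * ((m : ℂ) - 2 * j)) • v ∧
      ∃ c : ℂ, ∀ y : ℝ, ℓ (A[y] v) = c * (((Real.exp y : ℝ) : ℂ) ^ ((μ₁ + m + 1) / 2) * besselMode (4 * Real.pi) (ν - Complex.I * j) (Real.exp y)) := by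
  obtain ⟨hτb, hℓ, hθ₁, hθ₂, ha, hθa⟩ := complexPlace_hyps w hτu hℓW
  obtain ⟨x, ⟨hE, hT, -, -⟩, rfl⟩ := h.exists_inner
  obtain ⟨h1, c, hc⟩ := realShapeC_caseB2 hτ w hτb hℓ hθ₁ hθ₂ ha hθa μ₁ μ₂ m lama lamh ν hlama hlamh x hE hT hZ1 hZ2 (hCa x) hCh j
  exact ⟨h1, c, fun y => by rw [hc y, mul_assoc]⟩

end Shapes

/-! #### The compact torus and the Kirillov function on `ℂˣ` -/

section Units

variable {ℓ : archGardingSpace hcpt τ →ₗ[ℂ] ℂ}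

/-- **The compact torus acts through `e^{φ(it+μ₂)/2}`** on a vector of torus weight `it` (`τ(Z^I_w) = μ₂`).
[cite: JacquetLanglands1970, §6] -/
theorem gardingAct_expGL_cornerI_eq_exp_smul {v : archGardingSpace hcpt τ} {t μ₂ : ℂ} (hT : D Tc v = (Complex.I * t) • v)
    (hZ2 : D Zc v = μ₂ • v) (φ : ℝ) :
    gardingAct hτ (expGL (φ • Matrix.single (0 : Fin 2) (0 : Fin 2) 𝐜I)) v = Complex.exp ((Complex.I * t + μ₂) / 2 * φ) • v := by
  have h0 : D (Matrix.single 0 0 𝐜I) v = ((Complex.I * t + μ₂) / 2) • v := by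
    rw [gardingEnd_cornerI_apply, hT, hZ2, ← add_smul, smul_smul]
    congr 1; ring
  have hE : archDerivE hcpt τ (Matrix.single (0 : Fin 2) (0 : Fin 2) 𝐜I) (v : E) = ((Complex.I * t + μ₂) / 2) • (v : E) := by
    have h1 := congrArg Subtype.val h0
    rwa [coe_gardingEnd_apply, Submodule.coe_smul] at h1
  refine Subtype.ext ?_
  rw [coe_gardingAct_apply, apply_expGL_smul_eq_exp_smul hτ _ v.2 hE, Submodule.coe_smul]

/-- **From the radial form to `ℂˣ`**: `ℓ(τ(diag(ι_w(z),1)) v) = c e^{(it+μ₂) arg z / 2} Φ(|z|)`. [folklore] -/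
theorem kirillovC_eq_of_radial {v : archGardingSpace hcpt τ} {t μ₂ : ℂ} (hT : D Tc v = (Complex.I * t) • v)
    (hZ2 : D Zc v = μ₂ • v) {Φ : ℝ → ℂ} {c : ℂ} (h : ∀ y : ℝ, ℓ (A[y] v) = c * Φ (Real.exp y)) (z : ℂˣ) :
    ℓ (gardingAct hτ (diagGL2 (complexUnitAt K w z) 1) v) =
      c * Complex.exp ((Complex.I * t + μ₂) / 2 * (Complex.arg (z : ℂ) : ℂ)) * Φ ‖(z : ℂ)‖ := by
  rw [diagGL2_complexUnitAt, gardingAct_mul, Module.End.mul_apply, gardingAct_expGL_cornerI_eq_exp_smul w hT hZ2, map_smul,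
    map_smul, smul_eq_mul, h, Real.exp_log (norm_pos_iff.mpr z.ne_zero)]
  ring

end Units

/-! #### Transport of the complex types by commuting operators -/

section Transport

variable {Φ : Module.End ℂ (archGardingSpace hcpt τ)}
  (h1 : ∀ i j : Fin 2, Commute Φ (gardingEnd hτ (Matrix.single i j ((0, Pi.single w 1) : mixedSpace K))))
  (h2 : ∀ i j : Fin 2, Commute Φ (gardingEnd hτ (Matrix.single i j ((0, Pi.single w Complex.I) : mixedSpace K))))
include h1 h2

/-- An operator commuting with the place-`w` letters commutes with `τ^h(E_{ij})`, `τ^a(E_{ij})`, `τ(T_w)`.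
[folklore] -/
theorem commute_complexPlace_ops :
    (∀ i j : Fin 2, Commute Φ (Dh[i,j])) ∧ (∀ i j : Fin 2, Commute Φ (Da[i,j])) ∧ Commute Φ (D Tc) := by
  refine ⟨fun i j => (h1 i j).sub_right ((h2 i j).smul_right _), fun i j => (h1 i j).add_right ((h2 i j).smul_right _), ?_⟩
  rw [gardingEnd_sub]
  exact (h2 0 0).sub_right (h2 1 1)

variable (hR : Commute Φ (gardingAct hτ (expGL ((Real.pi / 2 : ℝ) •
    (Matrix.single (0 : Fin 2) (1 : Fin 2) ((0, Pi.single w 1) : mixedSpace K) - Matrix.single (1 : Fin 2) (0 : Fin 2) ((0, Pi.single w 1) : mixedSpace K))))))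
include hR

/-- Transport of the inner data. [folklore] -/
theorem ComplexInner.map {y : archGardingSpace hcpt τ} {m : ℕ} (h : ComplexInner hτ w y m) : ComplexInner hτ w (Φ y) m := by
  obtain ⟨hh, ha, hT⟩ := commute_complexPlace_ops w h1 h2
  obtain ⟨hE, hTy, hFm, c, hc, hRy⟩ := h
  have hF : Commute Φ (Dh[1,0] - Da[0,1]) := (hh 1 0).sub_right (ha 0 1)
  refine ⟨?_, ?_, ?_, c, hc, ?_⟩
  · rw [← Module.End.mul_apply, ← ((hh 0 1).sub_right (ha 1 0)).eq, Module.End.mul_apply, hE, map_zero]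
  · rw [← Module.End.mul_apply, ← hT.eq, Module.End.mul_apply, hTy, map_smul]
  · rw [← Module.End.mul_apply, ← (hF.pow_right (m + 1)).eq, Module.End.mul_apply, hFm, map_zero]
  · rw [← Module.End.mul_apply, ← hR.eq, Module.End.mul_apply, hRy, map_smul, ← Module.End.mul_apply Φ, (hF.pow_right m).eq,
      Module.End.mul_apply]

/-- Transport of `ComplexHolPow`. [folklore] -/
theorem ComplexHolPow.map {v : archGardingSpace hcpt τ} {b m : ℕ} (h : ComplexHolPow hτ w v b m) : ComplexHolPow hτ w (Φ v) b m := by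
  obtain ⟨hh, -, -⟩ := commute_complexPlace_ops w h1 h2
  obtain ⟨y, hy, rfl⟩ := h.exists_inner
  refine ⟨Φ y, hy.map w h1 h2 hR, ?_⟩
  rw [← Module.End.mul_apply, ((hh 0 1).pow_right b).eq, Module.End.mul_apply]

/-- Transport of `ComplexAntiPowLowest`. [folklore] -/
theorem ComplexAntiPowLowest.map {v : archGardingSpace hcpt τ} {b m : ℕ} (h : ComplexAntiPowLowest hτ w v b m) :
    ComplexAntiPowLowest hτ w (Φ v) b m := by
  obtain ⟨hh, ha, -⟩ := commute_complexPlace_ops w h1 h2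
  obtain ⟨y, hy, rfl⟩ := h.exists_inner
  have hF : Commute Φ (Dh[1,0] - Da[0,1]) := (hh 1 0).sub_right (ha 0 1)
  refine ⟨Φ y, hy.map w h1 h2 hR, ?_⟩
  rw [← Module.End.mul_apply Φ, ((ha 0 1).pow_right b).eq, Module.End.mul_apply, ← Module.End.mul_apply Φ, (hF.pow_right m).eq,
    Module.End.mul_apply]

/-- Transport of `ComplexString`. [folklore] -/
theorem ComplexString.map {v : archGardingSpace hcpt τ} {j m : ℕ} (h : ComplexString hτ w v j m) : ComplexString hτ w (Φ v) j m := by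
  obtain ⟨hh, ha, -⟩ := commute_complexPlace_ops w h1 h2
  obtain ⟨y, hy, rfl⟩ := h.exists_inner
  have hF : Commute Φ (Dh[1,0] - Da[0,1]) := (hh 1 0).sub_right (ha 0 1)
  refine ⟨h.le, Φ y, hy.map w h1 h2 hR, ?_⟩
  rw [← Module.End.mul_apply, (hF.pow_right j).eq, Module.End.mul_apply]

end Transport

section Commuting

/-- `τ(diag(u',1))` commutes with the place-`w` letters when `u'_w = 1` (complex place). [folklore] -/
theorem commute_gardingAct_diagGL2_lettersC {u' : (mixedSpace K)ˣ} (hu' : (u' : mixedSpace K).2 w = 1) (a : ℂ) (i j : Fin 2) :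
    Commute (gardingAct hτ (diagGL2 u' 1)) (D (Matrix.single i j ((0, Pi.single w a) : mixedSpace K))) := by
  change gardingAct hτ (diagGL2 u' 1) * D (Matrix.single i j ((0, Pi.single w a) : mixedSpace K)) =
    D (Matrix.single i j ((0, Pi.single w a) : mixedSpace K)) * gardingAct hτ (diagGL2 u' 1)
  rw [gardingAct_mul_gardingEnd, conj_single_complexIdem_eq w u' hu']

/-- `τ(diag(u',1))` commutes with the Weyl rotation of the place `w` when `u'_w = 1`. [folklore] -/
theorem commute_gardingAct_diagGL2_weylRotC {u' : (mixedSpace K)ˣ} (hu' : (u' : mixedSpace K).2 w = 1) :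
    Commute (gardingAct hτ (diagGL2 u' 1)) (Rc) := by
  change gardingAct hτ (diagGL2 u' 1) * Rc = Rc * gardingAct hτ (diagGL2 u' 1)
  rw [← gardingAct_mul, ← gardingAct_mul]
  congr 1
  refine Units.ext ?_
  have hc : (diagGL2 u' 1 : GL (Fin 2) (mixedSpace K)) * (Matrix.single (0 : Fin 2) (1 : Fin 2) 𝐜 - Matrix.single (1 : Fin 2) (0 : Fin 2) 𝐜) *
      ((diagGL2 u' 1)⁻¹ : GL (Fin 2) (mixedSpace K)) = (Matrix.single (0 : Fin 2) (1 : Fin 2) 𝐜 - Matrix.single (1 : Fin 2) (0 : Fin 2) 𝐜) := by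
    rw [mul_sub, sub_mul, conj_single_complexIdem_eq w u' hu', conj_single_complexIdem_eq w u' hu']
  have hcomm : Commute ((diagGL2 u' 1 : GL (Fin 2) (mixedSpace K)) : Matrix (Fin 2) (Fin 2) (mixedSpace K))
      ((Real.pi / 2 : ℝ) • (Matrix.single (0 : Fin 2) (1 : Fin 2) 𝐜 - Matrix.single (1 : Fin 2) (0 : Fin 2) 𝐜)) := by
    refine Commute.smul_right ?_ _
    have h := congrArg (fun M => M * ((diagGL2 u' 1 : GL (Fin 2) (mixedSpace K)) : Matrix (Fin 2) (Fin 2) (mixedSpace K))) hc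
    rw [Matrix.mul_assoc, ← Units.val_mul, inv_mul_cancel, Units.val_one, Matrix.mul_one] at h
    exact h
  rw [Units.val_mul, Units.val_mul, coe_expGL]
  exact hcomm.exp_right.eq

end Commuting

end ComplexPlace

end Literature.NumberTheory.Automorphic
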